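import Summits.ResolutionOfSingularities.ResolutionOfSingularities.Theorems.DefectWalksDeepHolds
import Summits.ResolutionOfSingularities.ResolutionOfSingularities.Theorems.WallFrames17
import Summits.ResolutionOfSingularities.ResolutionOfSingularities.Theorems.MaxContactCutWallCut
import Summits.ResolutionOfSingularities.ResolutionOfSingularities.Theorems.MaxContactCutFreezeCutDead
import Summits.ResolutionOfSingularities.ResolutionOfSingularities.Theorems.MaxContactCutCoefficientCut
import Summits.ResolutionOfSingularities.ResolutionOfSingularities.Theorems.MaxContactCutTightCut
import Summits.ResolutionOfSingularities.ResolutionOfSingularities.Theorems.MaxContactCutFloorCut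
import Summits.ResolutionOfSingularities.ResolutionOfSingularities.Theorems.MaxContactCutConeCutCells
import Summits.ResolutionOfSingularities.ResolutionOfSingularities.Theorems.MaxContactCutBoundaryLedger
import Summits.ResolutionOfSingularities.ResolutionOfSingularities.Theorems.MaxContactCutLassoCutAsides
import Summits.ResolutionOfSingularities.ResolutionOfSingularities.Theorems.MaxContactCutFrobeniusDescent
import Summits.ResolutionOfSingularities.ResolutionOfSingularities.Theorems.MaxContactCutTightDefect
import Summits.ResolutionOfSingularities.ResolutionOfSingularities.Theorems.MaxContactCutUniformWalks
import Summits.ResolutionOfSingularities.ResolutionOfSingularities.Theorems.TowerDictionaryHoldsC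
import Summits.ResolutionOfSingularities.ResolutionOfSingularities.Theorems.ItineraryCutClasses
import HarnessLib

/-!
# ColumnLedger — the `|σ| = 3` forced-walk column and the pure-head slice of 30253 are THEOREMS

NODE (decomp-res-lens-5, gen 40; RESIDUAL MODE; lens «finite/base range + asymptotic regime + bridge»).  0-weight LEDGER
file (critic ROW 232 (Q1): «LossyGate v2 after WildDescent13/14 land, with `hW` discharged BY NAME»; ROW 232 (Q2a): «with
lens-3's `lawLossEntry` it then closes 31768/31769 and the 30253-slice `PolyPureTowersTerminate` BY NAME — no second
payment to anyone for that composition»).  Every declaration below is a COMPOSITION of LANDED theorems by name; nothing is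
re-typed, no port, no fact, no hypothesis.

**Target.** The polynomial pure-head SLICE of the host aside 30253 `MaxContactCut.NoForcedTowers`:
`TightDefectClasses.PolyPureTowersTerminate` — no infinite forced point tower is rooted at `(𝔸⁴_k, (Z^{pᵉ} + F), ∅, pᵉ)`,
`k` perfect, EVERY `e ≥ 1` — together with the whole `|σ| = 3` model column (Hauser's point-blow-up walks of the cleaned
pure head over perfect fields).

**Node (all three pieces of the lens DECIDED, so the target is a theorem).**
  Target ⟸ WILD [`WallCut.NoWildBalancedStrictTailsDeep` · DECIDED `WildDescent.noWildBalancedStrictTailsDeep_holds`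
            (lens-5 g36, Theorems/WildDescent13)]
         ∧ LOSSY [`WallCut.NoLossyStrictTailsDeep` · DECIDED `LossEpisode.noLossyStrictTailsDeep` (lens-3 g29, critic ROW 250,
            Theorems/LossEntryW33)]
         ∧ DICTIONARY [`TightDefectClasses.TowerDictionary` · DECIDED `TowerDictionaryHolds.towerDictionary_holds`
            (lens-5 g39, critic ROW 246, Theorems/TowerDictionaryHolds)],
  the other four cells of the gate (`free point`, `high planar joint`, `δ-balanced boundary`, `tame δ-balanced strict`)
  being the tree's `ProximityCut.noFreePointTailsDeep_holds`, `GhostDescent.noHighPlanarJointTailsDeep_holds`,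
  `WallFrames.noBalancedBoundaryTailsDeep_holds`, `WallFrames.noTameBalancedStrictTailsDeep_holds` (all consumed inside
  `WildDescent.defectWalksDeep_iff_lossy`, Theorems/WildDescent14).

**Lens reading (why this is the lens's node, and what is new).** In the exponent axis `q = pᵉ` the FINITE BASE `e = 1`
(item 31768, previously closed only modulo the Cossart–Piltant 2019 Thm 1.5 (i) print, Theorems/MaxContactCutShallowPort)
is ABSORBED by the ASYMPTOTIC REGIME `e ≥ 2` through the monotone BRIDGE `FrobeniusDescentClasses.defectOne_of_defectDeep`
(Frobenius lift `walksAt_antitone`: a bad walk at exponent `pᵉ` is a bad walk at `p^{e'}`, `e ≤ e'`), and the scheme/model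
BRIDGE is the dictionary: so `PolyPureTowersShallow` (31768) and the whole slice `PolyPureTowersTerminate` are now
FACT-FREE theorems — the CP2019 fact is no longer used anywhere on this column.  «Why novel»: the first hypothesis-free,
fact-free proof in the tree that NO polynomial pure-head datum `Z^{pᵉ} + F(u₁,u₂,u₃)` over a perfect field of
characteristic `p` carries an infinite forced point tower, for every `p` and every `e ≥ 1` (Moh–Hauser kangaroo walks
included), assembled from three independently decided cells.

**Ledger (route items of `route-ResolutionOfSingularities-MaxContactCut` proved BY NAME below; all were `open` on
2026-08-31T23:25Z).**  [31770 `DefectWalksDeep` and 31769 `PolyPureTowersDeep` are closed by the census's one-liners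
Theorems/DefectWalksDeepHolds + Theorems/PolyPureTowersDeepHolds (critic RULING 2026-08-31T23:29:41Z), imported here] · 33331 `DefectWalksOne` · 33330 `PrimDefectWalksDeep` · 33332 `PrimWalks` ·
33494 `UWAlgWalksTerminate` · 33348 `LCNoLassos` · 33349 `LCNoAperiodicWalks` · 33350 `LCNoDefectLassosDeep` ·
33351 `LCNoAperiodicDefectWalksDeep` · 31870 `ICNoPlateauDeep` · 33393 `BLNoCriticalFreePlateauxDeep` · 33396 `BLSatDefectDeep` ·
27645 `FLNoHighPlateauxDeepTwo` · 27861 `CCNoTameMixedTailsDeep` · 28122 `CFNoSkewJointTailsDeep` ·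
28532 `TightNoJointTailsFromFourDeep` · 27367 `ECNoSmallDeadStrictHighSkewJointTailsDeep` (lens-3's cell; composition only) ·
31768 `PolyPureTowersShallow` — SEVENTEEN items here (+ the census's two = the whole column).  NOT closed: 33493 `UWFiniteFieldCriterion`
(only modulo the typed port `UniformWalks.CompactnessPort` via `UniformWalks.sliceTerminate_iff_exists_unifBound` and
`UniformWalks.sliceTerminate_of_walksTerminate walksTerminate_holds`; the port is not proved in the tree).

**Honest scope.** NOT a proof of 30253 `NoForcedTowers`: the slice is NECESSARY for it
(`MaxContactCutTightDefect.polyPureTowersTerminate_of_noForcedTowers`) and nothing here bears on general forced towers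
(lens-4's root `HugValuationCut.noForcedTowers_of_g45`, 13 binders, untouched); 31771 `PolyPureReduction` (the E-format
rung above the slice: weak resolution of pure-head data) untouched; no placeholders, axioms standard.
[folklore]
-/

noncomputable section

namespace Summit.ResolutionOfSingularities.ResolutionOfSingularities.Theorems.ColumnLedger

open Summit.ResolutionOfSingularities.ResolutionOfSingularities.Theses
open Summit.ResolutionOfSingularities.ResolutionOfSingularities.Theorems

/-! ## §1 The gate, discharged (31770 = census `DefectWalksDeepHolds`): WILD `WildDescent.noWildBalancedStrictTailsDeep_holds` ∧ LOSSY `LossEpisode.noLossyStrictTailsDeep` -/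

/-- 31770 at the Theorems-side type: the census's by-name closer `DefectWalksDeepHolds.defectWalksDeep_holds`
(`= WildDescent.defectWalksDeep_of_lossy' LossEpisode.noLossyStrictTailsDeep`) through the definitional unfolding
`MaxContactCutTightDefect.defectWalksDeep_iff`. [composition] [folklore] -/
theorem defectWalksTerminateDeep_holds : TightDefectClasses.DefectWalksTerminateDeep :=
  MaxContactCutTightDefect.defectWalksDeep_iff.mp DefectWalksDeepHolds.defectWalksDeep_holds

/-! ## §2 The model column, every exponent `e ≥ 1` (Frobenius lift = the bridge from the asymptotic regime to the base) -/

/-- **`WalksTerminate` HOLDS** — ALL forced point walks of cleaned pure heads `Z^{pᵉ} + F(u₁,u₂,u₃)`, every `e ≥ 1`, every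
perfect field of characteristic `p`, terminate (`MaxContactCutFrobeniusDescent.defectWalksDeep_iff_walksTerminate`).
[composition] [folklore] -/
theorem walksTerminate_holds : TightDefectClasses.WalksTerminate :=
  MaxContactCutFrobeniusDescent.defectWalksDeep_iff_walksTerminate.mp DefectWalksDeepHolds.defectWalksDeep_holds

/-- **33331 `MaxContactCut.DefectWalksOne` HOLDS** (the base `e = 1`, heads `Z^p + F`, by Frobenius lift from the deep
column). [composition] [folklore] -/
theorem defectWalksOne_holds : MaxContactCut.DefectWalksOne :=
  FrobeniusDescentClasses.defectOne_of_defectDeep defectWalksTerminateDeep_holds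

/-- **33330 `MaxContactCut.PrimDefectWalksDeep` HOLDS** (primitive deep column). [composition] [folklore] -/
theorem primDefectWalksDeep_holds : MaxContactCut.PrimDefectWalksDeep :=
  FrobeniusDescentClasses.primDefectDeep_of_defectDeep defectWalksTerminateDeep_holds

/-- **33332 `MaxContactCut.PrimWalks` HOLDS** (primitive columns, all exponents). [composition] [folklore] -/
theorem primWalks_holds : MaxContactCut.PrimWalks :=
  FrobeniusDescentClasses.walksTerminate_iff_prim.mp walksTerminate_holds

/-- **33494 `MaxContactCut.UWAlgWalksTerminate` HOLDS** (walks over algebraic, i.e. locally finite, fields).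
[composition] [folklore] -/
theorem uwAlgWalksTerminate_holds : MaxContactCut.UWAlgWalksTerminate :=
  UniformWalks.uwAlgWalksTerminate_of_walksTerminate walksTerminate_holds

/-- **33348 `MaxContactCut.LCNoLassos` HOLDS** (no finite lasso). [composition] [folklore] -/
theorem lcNoLassos_holds : MaxContactCut.LCNoLassos :=
  MaxContactCutLassoCutAsides.lcNoLassos_iff.mpr (LassoCut.noLassos_of_walks walksTerminate_holds)

/-- **33349 `MaxContactCut.LCNoAperiodicWalks` HOLDS** (no aperiodic walk). [composition] [folklore] -/
theorem lcNoAperiodicWalks_holds : MaxContactCut.LCNoAperiodicWalks :=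
  MaxContactCutLassoCutAsides.lcNoAperiodicWalks_iff.mpr (LassoCut.noAperiodic_of_walks walksTerminate_holds)

/-- **33350 `MaxContactCut.LCNoDefectLassosDeep` HOLDS**. [composition] [folklore] -/
theorem lcNoDefectLassosDeep_holds : MaxContactCut.LCNoDefectLassosDeep :=
  MaxContactCutLassoCutAsides.lcNoDefectLassosDeep_iff.mpr
    (LassoCut.noDefectLassosDeep_of_defectDeep defectWalksTerminateDeep_holds)

/-- **33351 `MaxContactCut.LCNoAperiodicDefectWalksDeep` HOLDS**. [composition] [folklore] -/
theorem lcNoAperiodicDefectWalksDeep_holds : MaxContactCut.LCNoAperiodicDefectWalksDeep :=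
  MaxContactCutLassoCutAsides.lcNoAperiodicDefectWalksDeep_iff.mpr
    (LassoCut.noAperiodicDefectDeep_of_defectDeep defectWalksTerminateDeep_holds)

/-- **31870 `MaxContactCut.ICNoPlateauDeep` HOLDS** (no infinite plateau tail; `ItineraryCutClasses.noPlateau_of_deep`).
[composition] [folklore] -/
theorem icNoPlateauDeep_holds : MaxContactCut.ICNoPlateauDeep :=
  ItineraryCutClasses.noPlateau_of_deep defectWalksTerminateDeep_holds

/-- **33393 `MaxContactCut.BLNoCriticalFreePlateauxDeep` HOLDS** (`MaxContactCutBoundaryLedger.blNoCritical_of_icNoPlateau`).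
[composition] [folklore] -/
theorem blNoCriticalFreePlateauxDeep_holds : MaxContactCut.BLNoCriticalFreePlateauxDeep :=
  MaxContactCutBoundaryLedger.blNoCritical_of_icNoPlateau icNoPlateauDeep_holds

/-- **33396 `MaxContactCut.BLSatDefectDeep` HOLDS** (`BoundaryLedger.satDeep_of_deep`). [composition] [folklore] -/
theorem blSatDefectDeep_holds : MaxContactCut.BLSatDefectDeep :=
  MaxContactCutBoundaryLedger.blSatDefectDeep_iff.mpr (BoundaryLedger.satDeep_of_deep defectWalksTerminateDeep_holds)

/-- **27645 `MaxContactCut.FLNoHighPlateauxDeepTwo` HOLDS** (`FloorCut.highTwo_of_defectWalksDeep`). [composition] [folklore] -/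
theorem flNoHighPlateauxDeepTwo_holds : MaxContactCut.FLNoHighPlateauxDeepTwo :=
  FloorCut.highTwo_of_defectWalksDeep DefectWalksDeepHolds.defectWalksDeep_holds

/-- **27861 `MaxContactCut.CCNoTameMixedTailsDeep` HOLDS** (second conjunct of `ConeCut.highTwo_iff_free_tame`).
[composition] [folklore] -/
theorem ccNoTameMixedTailsDeep_holds : MaxContactCut.CCNoTameMixedTailsDeep :=
  (ConeCut.highTwo_iff_free_tame.mp flNoHighPlateauxDeepTwo_holds).2

/-- **28122 `MaxContactCut.CFNoSkewJointTailsDeep` HOLDS** (`CoefficientCut.skew_of_defectWalksDeep`). [composition] [folklore] -/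
theorem cfNoSkewJointTailsDeep_holds : MaxContactCut.CFNoSkewJointTailsDeep :=
  CoefficientCut.skew_of_defectWalksDeep DefectWalksDeepHolds.defectWalksDeep_holds

/-- **28532 `MaxContactCut.TightNoJointTailsFromFourDeep` HOLDS** (`TightCut.four_of_defectWalksDeep`). [composition] [folklore] -/
theorem tightNoJointTailsFromFourDeep_holds : MaxContactCut.TightNoJointTailsFromFourDeep :=
  TightCut.four_of_defectWalksDeep DefectWalksDeepHolds.defectWalksDeep_holds

/-- **27367 `MaxContactCut.ECNoSmallDeadStrictHighSkewJointTailsDeep` HOLDS** — lens-3's column item (critic ROW 250 paid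
lens-3 for the LOSSY law; this line is the 0-weight composition): the tree's EXACT carve
`WallCut.smallDeadStrict_iff_lossy_tame_wild` with LOSSY (`LossEpisode.noLossyStrictTailsDeep`), TAME
(`WallFrames.noTameBalancedStrictTailsDeep_holds`, WallFrames17) and WILD (`WildDescent.noWildBalancedStrictTailsDeep_holds`,
WildDescent13) all decided. [composition] [folklore] -/
theorem ecNoSmallDeadStrictHighSkewJointTailsDeep_holds : MaxContactCut.ECNoSmallDeadStrictHighSkewJointTailsDeep :=
  WallCut.smallDeadStrict_iff_lossy_tame_wild.mpr
    ⟨LossEpisode.noLossyStrictTailsDeep, WallFrames.noTameBalancedStrictTailsDeep_holds,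
      WildDescent.noWildBalancedStrictTailsDeep_holds⟩

/-! ## §3 The scheme column: the pure-head slice of 30253, FACT-FREE (dictionary = the scheme/model bridge) -/

/-- **THE SLICE OF 30253 HOLDS, hypothesis-free and fact-free: `TightDefectClasses.PolyPureTowersTerminate`** — no
infinite forced point tower (tree `ForcedTower`) is rooted at a polynomial pure-head datum `(𝔸⁴_k, (Z^{pᵉ} + F), ∅, pᵉ)`,
`k` perfect of characteristic `p`, for every prime `p` and EVERY `e ≥ 1`: the dictionary `towerDictionary_holds` (lens-5
g39) transports the model statement `walksTerminate_holds`.  The Cossart–Piltant 2019 fact used for `e = 1` in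
Theorems/MaxContactCutShallowPort is NOT used. [composition] [folklore] -/
theorem polyPureTowersTerminate_holds : TightDefectClasses.PolyPureTowersTerminate :=
  TightDefectClasses.polyPureTowersTerminate_of_model TowerDictionaryHolds.towerDictionary_holds walksTerminate_holds

/-- **31768 `MaxContactCut.PolyPureTowersShallow` HOLDS, FACT-FREE** (`e = 1`; supersedes the CP2019-conditional
`MaxContactCutShallowPort.polyPureTowersShallow_of_cp` for the purpose of the item). [composition] [folklore] -/
theorem polyPureTowersShallow_holds : MaxContactCut.PolyPureTowersShallow :=
  MaxContactCutTightDefect.polyPureTowersShallow_iff.mpr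
    (TightDefectClasses.shallow_of_polyPureTowers polyPureTowersTerminate_holds)

end Summit.ResolutionOfSingularities.ResolutionOfSingularities.Theorems.ColumnLedger
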